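/-
Copyright: the b2b-balaban T⁴-continuum CRUX team, row NE7b OWNER lineage `t4-ne7b-p1` (gen 140). Project licence.
-/
import Summits.QuantumFields.BalabanUV.T4Continuum.Spine.NE7b.SupWhitenedFirstOrderLetters
import Summits.QuantumFields.BalabanUV.T4Continuum.Spine.NE7b.SupBlockCovarianceKernelLetter

/-!
# THE COVARIANCE KERNEL LETTER WITHOUT A PRECISION CONDITION (SCOPING (d11)(3) CLOSED BY WHITENING): for ANY factorisation
# `Γ = A·Aᵀ` of the fluctuation covariance (`A : ι × κ` rectangular, `Γ` possibly SINGULAR — finite-range pieces `Γ = Σ_jA_jA_jᵀ` give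
# `A = [A_1|…|A_k]`), the tilted law `e^{−U(ω+ψ)}dN(0,Γ)(ω)∕Z` is the image under `ω = Aξ` of the Gibbs law on `ℝ^κ`
#   `ν ∝ e^{−V(ξ)}dξ`,  `V(ξ) = ½|ξ|² + U(Aξ + ψ)`  — PRECISION = IDENTITY,
# so Dobrushin's single-site condition has NO precision part at all: with (456)'s whitened letters (cross majorant
# `HA_{xw} = Σ_{u,v}|A_{uw}||A_{vx}|Hk_{vu}`, diagonal `lamA`, observables' vectors `Σ_u|A_{uw}|Hk_{vu}`) it reads
#   `αc·hr·αr ≤ γ(1 − lamA)`, `γ < 1`  (columns `≤ γ′ < 1`)  — PURE SMALLNESS of the input kernel against the factor's `ℓ¹` letters,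
# and (447) gives, UNIFORMLY IN THE BACKGROUND `ψ` AND THE VOLUME,
#   `Σ_y |C_{xy}(ψ)| ≤ (hr·αr)·(αc·hc)·(1−γ)⁻¹(1−γ′)⁻¹ ∕ (1 − lamA)`,   `C_{xy}(ψ)` the tilted covariance of `U′e_x, U′e_y` under `N(0,AAᵀ)`,
# and the ENTRY bound `|C_{xy}(ψ)| ≤ Σ_w (Dᵀa_x)_w(Dᵀa_y)_w∕(1−lamA)` for every `D ≥ 0` with `I + D·C ≤ D`.  The diagonal-dominance hypothesis of
# (449)∕(450)∕(452)∕(454) on `Γ⁻¹` — false for block-spin precisions and unstated for singular `Γ` — is GONE (row NE7b, node U5c; (447),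
# (448), (450), (456), `Literature.…multivariateGaussian_map_matrix` BY NAME; [folklore: Dobrushin 1970, Föllmer 1982])

Cell `pub-balaban`, sub-cell `t4`, spine estimate NE7b (`T4WeightBudget.RelWeightBound`; the cell's OWN estimate — NOT PRINTED in
[Bałaban 1983–89], NOT PROVED).  Crux-route work under `Spine/NE7b/` by the row OWNER (`t4-ne7b-p1` gen 140, file (457)) under FREEZE
(0)'s crux-prover clause; NOTHING of Bałaban's is named as a Lean object, valued or asserted; no `T4Continuum/Support` leaf typed; no
`def`, no notation (`V`, `V₁`, `HA`, the observables' vectors, Dobrushin's `J`, `C`, `D` WRITTEN OUT; the sampler hypothesis-characterised);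
zero `sorry`.  Imports (BY NAME): the OWNER's (456) `…SupWhitenedFirstOrderLetters` (`whitened_hasFDerivAt`, `whitened_cross∕ceiling∕floor`,
`whitened_obs_lipVec`, the letters), (450) `…SupBlockCovarianceKernelLetter` (`tilted_integral_eq_gauss`, `integrable_lebesgue_of_gauss`;
through it (449) `tilted_line_hasDerivAt∕floor∕ceiling∕cross∕continuous`, (447) `abs_cov_le_kernel_gibbs`, `cov_rowsum_le_gibbs`, (448)
`neumann_*`), `Literature.Probability.Distributions.GaussianLinearCompensation` (`multivariateGaussian_map_matrix`).

WHAT IS PROVED ([folklore]; `A : Matrix ι κ ℝ`, `T = matrixCLM A`, `U ∈ C²`, `|U″(φ)[e_z][e_x]| ≤ Hk_{xz}`, letters `αr, αc, hr, hc, lamA`):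
* §1 the structural hypotheses of (447) for `V(z) = ½z·z + U(T toLp z + ψ)` on `ℝ^κ`: `whitenedV_hasDerivAt` (`V₁_x(z) = z_x + U′(T toLp z + ψ)(Te_x)`),
  `whitenedV_floor` (`c = 1 − lamA`), `whitenedV_ceiling` (`1 + lamA`), `whitenedV_cross` (`HA`), `whitenedV_continuous`.
* §2 the bridges: `whitened_tilted_eq_gauss` (`ν ↔ N(0,I_κ)`), `whitened_integrable_lebesgue`, **`whitened_integral_eq`** and
  `whitened_integrable_iff` (`N(0,AAᵀ) = N(0,I_κ)∘T⁻¹`: `∫f dN(0,AAᵀ) = ∫f(Tξ) dN(0,I)(ξ)`).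
* §3 in the Gibbs format on `ℝ^κ`: **`whitened_cov_entry_le_raw`** (any `D`), **`whitened_cov_rowsum_le_raw`** (Neumann `D`).
* §4 THE END in the road's format: **`whitened_cov_kernel_rowsum_le`** — `Σ_y|C_{xy}(ψ)| ≤ (hr·αr)(αc·hc)(1−γ)⁻¹(1−γ′)⁻¹∕(1−lamA)` under `N(0,AAᵀ)`.

HONEST (what this is NOT).  The moment letters `e^{−U(Tξ+ψ)}, e^{−U(Tξ+ψ)}ξ_w² ∈ L¹(N(0,I_κ))` are hypotheses here ((458) discharges them
from stability and the whitened regulator `2κ₀(1+τ)γ_A + 4δ ≤ θ < 1`, `γ_A ≥ ‖A‖²`); the output Hessian letters in this dress are (459); the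
factor `A` and its letters are inputs (for the road: the finite-range decomposition's factors).  Third-order kernel letters ((d11)(4)) NOT
touched.  Scalar skeleton ((A3), NC-NE7b-α UNRULED); nothing of Bałaban's asserted.  BY-NAME EFFECT ON THE WALL: NONE.  NE7b NOT PRINTED ∕
NOT PROVED; spine PROVED 0∕9; rung (B)+1 — the programme's measures remain FINITE-torus statements; NOT the mass gap, NOT Clay.  HONEST
DEPENDENCY: continuum YM on T⁴ ⇐ BetaPertH ∧ nine spine estimates (0∕9 proved); BetaPertH ⇐ (D1) ∧ (D4) ∧ CAP+tail; G-an2-4 gates asym,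
D1 and NE2∕3∕4.
-/

set_option autoImplicit false

noncomputable section

namespace Summit.QuantumFields.BalabanUV.T4Continuum.NE7b.SupWhitenedCovarianceKernelLetter

open MeasureTheory ProbabilityTheory Real Set Function Finset Matrix
open scoped BigOperators
open Literature.Probability.Distributions (matrixCLM multivariateGaussian_map_matrix)
open SupWhitenedFirstOrderLetters (matrixCLM_single_apply toLp_update_zero whitened_hasFDerivAt whitened_cross whitened_ceiling
  whitened_floor whitened_obs_lipVec whitened_cross_nonneg whitened_J_rowsum_le whitened_J_colsum_le whitened_obs_nonneg
  whitened_obs_rowsum_le whitened_obs_colsum_le)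
open SupBlockCovarianceKernelLetter (tilted_integral_eq_gauss integrable_lebesgue_of_gauss)
open SupTiltedCovarianceKernelLetter (tilted_line_hasDerivAt tilted_floor tilted_ceiling tilted_cross tilted_continuous)
open SupDobrushinCovarianceGibbs (abs_cov_le_kernel_gibbs cov_rowsum_le_gibbs)
open SupDobrushinNeumannMatrix (neumann_nonneg neumann_dominates neumann_rowsum_le neumann_colsum_le)

variable {ι κ : Type} [Fintype ι] [DecidableEq ι] [Fintype κ] [DecidableEq κ]

variable {U : EuclideanSpace ℝ ι → ℝ} {U' : EuclideanSpace ℝ ι → EuclideanSpace ℝ ι →L[ℝ] ℝ}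
  {U'' : EuclideanSpace ℝ ι → EuclideanSpace ℝ ι →L[ℝ] EuclideanSpace ℝ ι →L[ℝ] ℝ} {Hk : ι → ι → ℝ} {A : Matrix ι κ ℝ}
  {ψ : EuclideanSpace ℝ ι} {αr αc hr hc lamA γ γ' : ℝ} {D : κ → κ → ℝ} {P : κ → ((κ → ℝ) → ℝ) → ((κ → ℝ) → ℝ)}

/-! ## §1. The structural hypotheses of (447) for `V(z) = ½z·z + U(T toLp z + ψ)` on `ℝ^κ` -/

omit [DecidableEq ι] in
/-- **The line derivative**: `s ↦ V(z^{x,s})` has derivative `z_x + U′(T toLp z + ψ)(Te_x)` at `s = z_x` ((449) with `M = I`). [folklore] -/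
theorem whitenedV_hasDerivAt (hUd : ∀ φ : EuclideanSpace ℝ ι, HasFDerivAt U (U' φ) φ) (A : Matrix ι κ ℝ) (ψ : EuclideanSpace ℝ ι) (x : κ)
    (z : κ → ℝ) :
    HasDerivAt (fun s => 1 / 2 * (update z x s ⬝ᵥ update z x s) + U (matrixCLM A (WithLp.toLp 2 (update z x s)) + ψ))
      (z x + U' (matrixCLM A (WithLp.toLp 2 z) + ψ) (matrixCLM A (EuclideanSpace.single x (1 : ℝ)))) (z x) := by
  have h := tilted_line_hasDerivAt (M := (1 : Matrix κ κ ℝ)) Matrix.isSymm_one (whitened_hasFDerivAt hUd A ψ) (0 : EuclideanSpace ℝ κ) x z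
  simp only [Matrix.one_mulVec, add_zero, ContinuousLinearMap.comp_apply] at h
  exact h

/-- **The diagonal floor `c = 1 − lamA`**. [folklore] -/
theorem whitenedV_floor (hU'd : ∀ φ : EuclideanSpace ℝ ι, HasFDerivAt U' (U'' φ) φ)
    (hHk : ∀ (φ : EuclideanSpace ℝ ι) (x z : ι), |U'' φ (EuclideanSpace.single z (1 : ℝ)) (EuclideanSpace.single x (1 : ℝ))| ≤ Hk x z)
    (A : Matrix ι κ ℝ) (hlam : ∀ x : κ, ∑ u, ∑ v, |A u x| * |A v x| * Hk v u ≤ lamA) (ψ : EuclideanSpace ℝ ι) (x : κ) (z : κ → ℝ) (s t : ℝ) :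
    (1 - lamA) * (s - t) ^ 2 ≤
      ((update z x s x + U' (matrixCLM A (WithLp.toLp 2 (update z x s)) + ψ) (matrixCLM A (EuclideanSpace.single x (1 : ℝ)))) -
        (update z x t x + U' (matrixCLM A (WithLp.toLp 2 (update z x t)) + ψ) (matrixCLM A (EuclideanSpace.single x (1 : ℝ))))) * (s - t) := by
  have h := tilted_floor (M := (1 : Matrix κ κ ℝ)) (U' := fun η : EuclideanSpace ℝ κ => (U' (matrixCLM A η + ψ)).comp (matrixCLM A))
    (fun x φ r => whitened_floor hU'd hHk A hlam ψ x φ r) (0 : EuclideanSpace ℝ κ) x z s t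
  simp only [Matrix.one_mulVec, Matrix.one_apply_eq, add_zero, ContinuousLinearMap.comp_apply] at h
  exact h

/-- **The diagonal ceiling `1 + lamA`**. [folklore] -/
theorem whitenedV_ceiling (hU'd : ∀ φ : EuclideanSpace ℝ ι, HasFDerivAt U' (U'' φ) φ)
    (hHk : ∀ (φ : EuclideanSpace ℝ ι) (x z : ι), |U'' φ (EuclideanSpace.single z (1 : ℝ)) (EuclideanSpace.single x (1 : ℝ))| ≤ Hk x z)
    (A : Matrix ι κ ℝ) (hlam : ∀ x : κ, ∑ u, ∑ v, |A u x| * |A v x| * Hk v u ≤ lamA) (ψ : EuclideanSpace ℝ ι) (x : κ) (z : κ → ℝ) (s t : ℝ) :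
    |(update z x s x + U' (matrixCLM A (WithLp.toLp 2 (update z x s)) + ψ) (matrixCLM A (EuclideanSpace.single x (1 : ℝ)))) -
        (update z x t x + U' (matrixCLM A (WithLp.toLp 2 (update z x t)) + ψ) (matrixCLM A (EuclideanSpace.single x (1 : ℝ))))| ≤
      (1 + lamA) * |s - t| := by
  have hMdiag : ∀ x : κ, |(1 : Matrix κ κ ℝ) x x| ≤ 1 := fun x => by rw [Matrix.one_apply_eq, abs_one]
  have h := tilted_ceiling (M := (1 : Matrix κ κ ℝ)) (U' := fun η : EuclideanSpace ℝ κ => (U' (matrixCLM A η + ψ)).comp (matrixCLM A))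
    (fun x φ r => whitened_ceiling hU'd hHk A hlam ψ x φ r) hMdiag (0 : EuclideanSpace ℝ κ) x z s t
  simp only [Matrix.one_mulVec, add_zero, ContinuousLinearMap.comp_apply] at h
  exact h

/-- **The cross letters `HA_{xw} = Σ_{u,v}|A_{uw}||A_{vx}|Hk_{vu}`** (`w ≠ x`; the precision `I` contributes nothing). [folklore] -/
theorem whitenedV_cross (hU'd : ∀ φ : EuclideanSpace ℝ ι, HasFDerivAt U' (U'' φ) φ)
    (hHk : ∀ (φ : EuclideanSpace ℝ ι) (x z : ι), |U'' φ (EuclideanSpace.single z (1 : ℝ)) (EuclideanSpace.single x (1 : ℝ))| ≤ Hk x z)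
    (A : Matrix ι κ ℝ) (ψ : EuclideanSpace ℝ ι) (x w : κ) (hw : w ≠ x) (z : κ → ℝ) (s t : ℝ) :
    |(update z w s x + U' (matrixCLM A (WithLp.toLp 2 (update z w s)) + ψ) (matrixCLM A (EuclideanSpace.single x (1 : ℝ)))) -
        (update z w t x + U' (matrixCLM A (WithLp.toLp 2 (update z w t)) + ψ) (matrixCLM A (EuclideanSpace.single x (1 : ℝ))))| ≤
      (∑ u, ∑ v, |A u w| * |A v x| * Hk v u) * |s - t| := by
  have h := tilted_cross (M := (1 : Matrix κ κ ℝ)) (U' := fun η : EuclideanSpace ℝ κ => (U' (matrixCLM A η + ψ)).comp (matrixCLM A))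
    (H := fun x w => ∑ u, ∑ v, |A u w| * |A v x| * Hk v u) (fun x w φ r => whitened_cross hU'd hHk A ψ x w φ r) (0 : EuclideanSpace ℝ κ) x w z s t
  simp only [Matrix.one_mulVec, add_zero, ContinuousLinearMap.comp_apply, Matrix.one_apply_ne (fun e => hw e.symm), abs_zero, zero_add] at h
  exact h

omit [DecidableEq ι] in
/-- **`V` is continuous**. [folklore] -/
theorem whitenedV_continuous (hUd : ∀ φ : EuclideanSpace ℝ ι, HasFDerivAt U (U' φ) φ) (A : Matrix ι κ ℝ) (ψ : EuclideanSpace ℝ ι) :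
    Continuous fun z : κ → ℝ => 1 / 2 * (z ⬝ᵥ z) + U (matrixCLM A (WithLp.toLp 2 z) + ψ) := by
  classical
  have h := tilted_continuous (M := (1 : Matrix κ κ ℝ)) (whitened_hasFDerivAt hUd A ψ) (0 : EuclideanSpace ℝ κ)
  simp only [Matrix.one_mulVec, add_zero] at h
  exact h

/-! ## §2. The bridges `e^{−V}dz ↔ N(0,I_κ) ↔ N(0,AAᵀ)` -/

omit [DecidableEq ι] in
/-- **`∫g dν_V = ∫e^{−U(Tξ+ψ)}g(ofLp ξ)dN(0,I) ∕ ∫e^{−U(Tξ+ψ)}dN(0,I)`** ((450) with `M = I`). [folklore] -/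
theorem whitened_tilted_eq_gauss (A : Matrix ι κ ℝ) (ψ : EuclideanSpace ℝ ι) (g : (κ → ℝ) → ℝ) :
    ∫ z, g z ∂((volume : Measure (κ → ℝ)).tilted fun z => -(1 / 2 * (z ⬝ᵥ z) + U (matrixCLM A (WithLp.toLp 2 z) + ψ))) =
      (∫ ξ : EuclideanSpace ℝ κ, exp (-U (matrixCLM A ξ + ψ)) * g (WithLp.ofLp ξ) ∂(multivariateGaussian 0 (1 : Matrix κ κ ℝ))) /
        ∫ ξ : EuclideanSpace ℝ κ, exp (-U (matrixCLM A ξ + ψ)) ∂(multivariateGaussian 0 (1 : Matrix κ κ ℝ)) := by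
  have h := tilted_integral_eq_gauss (M := (1 : Matrix κ κ ℝ)) (U := fun η : EuclideanSpace ℝ κ => U (matrixCLM A η + ψ)) Matrix.PosDef.one
    (0 : EuclideanSpace ℝ κ) g
  simp only [Matrix.one_mulVec, add_zero, inv_one] at h
  exact h

omit [DecidableEq ι] in
/-- **Integrability transfers `N(0,I) → e^{−V}dz`**: `e^{−U(Tξ+ψ)}k(ξ) ∈ L¹(N(0,I))` ⟹ `k(toLp z)e^{−V(z)} ∈ L¹(dz)`. [folklore] -/
theorem whitened_integrable_lebesgue (A : Matrix ι κ ℝ) (ψ : EuclideanSpace ℝ ι) {k : EuclideanSpace ℝ κ → ℝ}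
    (hk : Integrable (fun ξ : EuclideanSpace ℝ κ => exp (-U (matrixCLM A ξ + ψ)) * k ξ) (multivariateGaussian 0 (1 : Matrix κ κ ℝ))) :
    Integrable (fun z : κ → ℝ => k (WithLp.toLp 2 z) * exp (-(1 / 2 * (z ⬝ᵥ z) + U (matrixCLM A (WithLp.toLp 2 z) + ψ)))) := by
  have h := integrable_lebesgue_of_gauss (M := (1 : Matrix κ κ ℝ)) (U := fun η : EuclideanSpace ℝ κ => U (matrixCLM A η + ψ)) Matrix.PosDef.one
    (0 : EuclideanSpace ℝ κ) (k := k) (by simpa only [add_zero, inv_one] using hk)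
  simp only [Matrix.one_mulVec, add_zero] at h
  exact h

/-- **THE PUSHFORWARD BRIDGE `N(0,AAᵀ) = N(0,I_κ)∘T⁻¹`**: `∫f dN(0,AAᵀ) = ∫f(Tξ) dN(0,I_κ)(ξ)` for `f` a.e.-strongly measurable.
(`Literature.….multivariateGaussian_map_matrix` BY NAME.) [folklore] -/
theorem whitened_integral_eq (A : Matrix ι κ ℝ) {f : EuclideanSpace ℝ ι → ℝ} (hf : AEStronglyMeasurable f (multivariateGaussian 0 (A * Aᵀ))) :
    ∫ ω, f ω ∂(multivariateGaussian 0 (A * Aᵀ)) = ∫ ξ, f (matrixCLM A ξ) ∂(multivariateGaussian 0 (1 : Matrix κ κ ℝ)) := by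
  have h := multivariateGaussian_map_matrix (Matrix.PosSemidef.one (n := κ) (R := ℝ)) A
  rw [Matrix.mul_one] at h
  rw [← h] at hf ⊢
  rw [integral_map (matrixCLM A).continuous.aemeasurable hf]

/-- **Integrability across the pushforward**: `f ∈ L¹(N(0,AAᵀ)) ↔ f∘T ∈ L¹(N(0,I_κ))`. [folklore] -/
theorem whitened_integrable_iff (A : Matrix ι κ ℝ) {f : EuclideanSpace ℝ ι → ℝ} (hf : AEStronglyMeasurable f (multivariateGaussian 0 (A * Aᵀ))) :
    Integrable f (multivariateGaussian 0 (A * Aᵀ)) ↔ Integrable (fun ξ => f (matrixCLM A ξ)) (multivariateGaussian 0 (1 : Matrix κ κ ℝ)) := by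
  have h := multivariateGaussian_map_matrix (Matrix.PosSemidef.one (n := κ) (R := ℝ)) A
  rw [Matrix.mul_one] at h
  rw [← h] at hf ⊢
  exact integrable_map_measure hf (matrixCLM A).continuous.aemeasurable

/-! ## §3. Dobrushin's estimate in whitened coordinates (the Gibbs format on `ℝ^κ`) -/

/-- **THE ENTRY BOUND IN WHITENED COORDINATES**: for `V(z) = ½z·z + U(T toLp z + ψ)`, the single-site sampler `P`, the letters of (456)
(`HA`, `lamA < 1`, Dobrushin's row condition `Σ_{w≠x}HA_{xw} ≤ γ(1 − lamA)`, `γ < 1`), ANY `D ≥ 0` with `I + D·C ≤ D` (`C_{xw} = HA_{xw}∕(1−lamA)`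
off the diagonal), and the moment letters: `|Cov_ν(F_x, F_y)| ≤ Σ_w (Dᵀa^x)_w(Dᵀa^y)_w∕(1 − lamA)`, `a^x_w = Σ_u|A_{uw}|Hk_{xu}`. [folklore] -/
theorem whitened_cov_entry_le_raw (hUd : ∀ φ : EuclideanSpace ℝ ι, HasFDerivAt U (U' φ) φ) (hU'd : ∀ φ : EuclideanSpace ℝ ι, HasFDerivAt U' (U'' φ) φ)
    (hHk : ∀ (φ : EuclideanSpace ℝ ι) (x z : ι), |U'' φ (EuclideanSpace.single z (1 : ℝ)) (EuclideanSpace.single x (1 : ℝ))| ≤ Hk x z)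
    (hHk0 : ∀ v u, 0 ≤ Hk v u) (A : Matrix ι κ ℝ) (ψ : EuclideanSpace ℝ ι)
    (hP : ∀ x F ω, P x F ω = (∫ s, F (update ω x s) * exp (-(1 / 2 * (update ω x s ⬝ᵥ update ω x s) + U (matrixCLM A (WithLp.toLp 2 (update ω x s)) + ψ)))) /
      ∫ s, exp (-(1 / 2 * (update ω x s ⬝ᵥ update ω x s) + U (matrixCLM A (WithLp.toLp 2 (update ω x s)) + ψ))))
    (hlam : ∀ x : κ, ∑ u, ∑ v, |A u x| * |A v x| * Hk v u ≤ lamA) (hlam1 : lamA < 1)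
    (hrow : ∀ x : κ, ∑ w, (if w = x then 0 else ∑ u, ∑ v, |A u w| * |A v x| * Hk v u) / (1 - lamA) ≤ γ) (hγ0 : 0 ≤ γ) (hγ1 : γ < 1)
    (hD : ∀ x y, 0 ≤ D x y)
    (hDC : ∀ x y, (if x = y then (1 : ℝ) else 0) + ∑ z, D x z * ((if y = z then 0 else ∑ u, ∑ v, |A u y| * |A v z| * Hk v u) / (1 - lamA)) ≤ D x y)
    (hI0 : Integrable (fun ξ : EuclideanSpace ℝ κ => exp (-U (matrixCLM A ξ + ψ))) (multivariateGaussian 0 (1 : Matrix κ κ ℝ)))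
    (hI2 : ∀ w, Integrable (fun ξ : EuclideanSpace ℝ κ => exp (-U (matrixCLM A ξ + ψ)) * ξ w ^ 2) (multivariateGaussian 0 (1 : Matrix κ κ ℝ)))
    (x y : ι) :
    |∫ z, U' (matrixCLM A (WithLp.toLp 2 z) + ψ) (EuclideanSpace.single x (1 : ℝ)) * U' (matrixCLM A (WithLp.toLp 2 z) + ψ) (EuclideanSpace.single y (1 : ℝ))
          ∂((volume : Measure (κ → ℝ)).tilted fun z => -(1 / 2 * (z ⬝ᵥ z) + U (matrixCLM A (WithLp.toLp 2 z) + ψ))) -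
        (∫ z, U' (matrixCLM A (WithLp.toLp 2 z) + ψ) (EuclideanSpace.single x (1 : ℝ))
          ∂((volume : Measure (κ → ℝ)).tilted fun z => -(1 / 2 * (z ⬝ᵥ z) + U (matrixCLM A (WithLp.toLp 2 z) + ψ)))) *
        (∫ z, U' (matrixCLM A (WithLp.toLp 2 z) + ψ) (EuclideanSpace.single y (1 : ℝ))
          ∂((volume : Measure (κ → ℝ)).tilted fun z => -(1 / 2 * (z ⬝ᵥ z) + U (matrixCLM A (WithLp.toLp 2 z) + ψ))))| ≤
      ∑ w, (∑ z, D z w * ∑ u, |A u z| * Hk x u) * (∑ z, D z w * ∑ u, |A u z| * Hk y u) / (1 - lamA) := by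
  have hcpos : ∀ _x : κ, 0 < 1 - lamA := fun _ => by linarith
  -- the moment letters in Lebesgue form
  have hV0 : Integrable (fun z : κ → ℝ => exp (-(1 / 2 * (z ⬝ᵥ z) + U (matrixCLM A (WithLp.toLp 2 z) + ψ)))) := by
    have h := whitened_integrable_lebesgue A ψ (k := fun _ => (1 : ℝ)) (by simpa only [mul_one] using hI0)
    simpa only [one_mul] using h
  have hV2 : ∀ w, Integrable (fun z : κ → ℝ => z w ^ 2 * exp (-(1 / 2 * (z ⬝ᵥ z) + U (matrixCLM A (WithLp.toLp 2 z) + ψ)))) := fun w => by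
    have h := whitened_integrable_lebesgue A ψ (k := fun ξ : EuclideanSpace ℝ κ => ξ w ^ 2) (hI2 w)
    simpa only [PiLp.toLp_apply] using h
  have hJ : ∀ x w : κ, 0 ≤ (if w = x then (0 : ℝ) else ∑ u, ∑ v, |A u w| * |A v x| * Hk v u) := fun x w => by
    split_ifs
    · exact le_rfl
    · exact whitened_cross_nonneg hHk0 A x w
  have hrow' : ∀ x : κ, ∑ w, (if w = x then (0 : ℝ) else ∑ u, ∑ v, |A u w| * |A v x| * Hk v u) / (1 - lamA) ≤ γ := hrow
  exact abs_cov_le_kernel_gibbs (P := P)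
    (V := fun z => 1 / 2 * (z ⬝ᵥ z) + U (matrixCLM A (WithLp.toLp 2 z) + ψ))
    (V₁ := fun x z => z x + U' (matrixCLM A (WithLp.toLp 2 z) + ψ) (matrixCLM A (EuclideanSpace.single x (1 : ℝ))))
    (c := fun _ => 1 - lamA) (Cw := 1 + lamA) (J := fun x w => if w = x then 0 else ∑ u, ∑ v, |A u w| * |A v x| * Hk v u) (γ := γ) (D := D)
    (F := fun z => U' (matrixCLM A (WithLp.toLp 2 z) + ψ) (EuclideanSpace.single x (1 : ℝ)))
    (G := fun z => U' (matrixCLM A (WithLp.toLp 2 z) + ψ) (EuclideanSpace.single y (1 : ℝ)))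
    (a := fun w => ∑ u, |A u w| * Hk x u) (b := fun w => ∑ u, |A u w| * Hk y u)
    hP (fun x z => whitenedV_hasDerivAt hUd A ψ x z) (fun x z s t => whitenedV_floor hU'd hHk A hlam ψ x z s t) hcpos
    (fun x z s t => whitenedV_ceiling hU'd hHk A hlam ψ x z s t)
    (fun x w hw z s t => by rw [if_neg hw]; exact whitenedV_cross hU'd hHk A ψ x w hw z s t)
    (whitenedV_continuous hUd A ψ) hV0 hV2 hJ (fun x => by simp) hrow' hγ0 hγ1 hD hDC
    (fun w z s t => whitened_obs_lipVec hU'd hHk A ψ x w z s t) (fun w z s t => whitened_obs_lipVec hU'd hHk A ψ y w z s t)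

/-- **THE KERNEL LETTER IN WHITENED COORDINATES** with the Neumann `D = Σ_nC^n` of (448): rows `≤ γ < 1`, columns `≤ γ′ < 1` give
`Σ_y |Cov_ν(F_x, F_y)| ≤ (hr·αr)·(αc·hc)·(1−γ)⁻¹(1−γ′)⁻¹∕(1 − lamA)`. [folklore: Föllmer 1982] -/
theorem whitened_cov_rowsum_le_raw [Nonempty κ] (hUd : ∀ φ : EuclideanSpace ℝ ι, HasFDerivAt U (U' φ) φ) (hU'd : ∀ φ : EuclideanSpace ℝ ι, HasFDerivAt U' (U'' φ) φ)
    (hHk : ∀ (φ : EuclideanSpace ℝ ι) (x z : ι), |U'' φ (EuclideanSpace.single z (1 : ℝ)) (EuclideanSpace.single x (1 : ℝ))| ≤ Hk x z)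
    (hHk0 : ∀ v u, 0 ≤ Hk v u) (A : Matrix ι κ ℝ) (ψ : EuclideanSpace ℝ ι)
    (hP : ∀ x F ω, P x F ω = (∫ s, F (update ω x s) * exp (-(1 / 2 * (update ω x s ⬝ᵥ update ω x s) + U (matrixCLM A (WithLp.toLp 2 (update ω x s)) + ψ)))) /
      ∫ s, exp (-(1 / 2 * (update ω x s ⬝ᵥ update ω x s) + U (matrixCLM A (WithLp.toLp 2 (update ω x s)) + ψ))))
    (hαr : ∀ u, ∑ w, |A u w| ≤ αr) (hαc : ∀ w, ∑ u, |A u w| ≤ αc) (hhr : ∀ v, ∑ u, Hk v u ≤ hr) (hhc : ∀ u, ∑ v, Hk v u ≤ hc)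
    (hlam : ∀ x : κ, ∑ u, ∑ v, |A u x| * |A v x| * Hk v u ≤ lamA) (hlam1 : lamA < 1)
    (hγ : αc * hr * αr / (1 - lamA) ≤ γ) (hγ1 : γ < 1) (hγ' : αc * hc * αr / (1 - lamA) ≤ γ') (hγ'1 : γ' < 1)
    (hI0 : Integrable (fun ξ : EuclideanSpace ℝ κ => exp (-U (matrixCLM A ξ + ψ))) (multivariateGaussian 0 (1 : Matrix κ κ ℝ)))
    (hI2 : ∀ w, Integrable (fun ξ : EuclideanSpace ℝ κ => exp (-U (matrixCLM A ξ + ψ)) * ξ w ^ 2) (multivariateGaussian 0 (1 : Matrix κ κ ℝ)))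
    (x : ι) :
    ∑ y, |∫ z, U' (matrixCLM A (WithLp.toLp 2 z) + ψ) (EuclideanSpace.single x (1 : ℝ)) * U' (matrixCLM A (WithLp.toLp 2 z) + ψ) (EuclideanSpace.single y (1 : ℝ))
          ∂((volume : Measure (κ → ℝ)).tilted fun z => -(1 / 2 * (z ⬝ᵥ z) + U (matrixCLM A (WithLp.toLp 2 z) + ψ))) -
        (∫ z, U' (matrixCLM A (WithLp.toLp 2 z) + ψ) (EuclideanSpace.single x (1 : ℝ))
          ∂((volume : Measure (κ → ℝ)).tilted fun z => -(1 / 2 * (z ⬝ᵥ z) + U (matrixCLM A (WithLp.toLp 2 z) + ψ)))) *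
        (∫ z, U' (matrixCLM A (WithLp.toLp 2 z) + ψ) (EuclideanSpace.single y (1 : ℝ))
          ∂((volume : Measure (κ → ℝ)).tilted fun z => -(1 / 2 * (z ⬝ᵥ z) + U (matrixCLM A (WithLp.toLp 2 z) + ψ))))| ≤
      hr * αr * (αc * hc) * (1 - γ)⁻¹ * (1 - γ')⁻¹ / (1 - lamA) := by
  haveI : Nonempty ι := ⟨x⟩
  have hl1 : 0 < 1 - lamA := by linarith
  have hcpos : ∀ _x : κ, 0 < 1 - lamA := fun _ => hl1
  -- Dobrushin's matrix (no precision part) and its Neumann series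
  set Cm : Matrix κ κ ℝ := Matrix.of fun x w => (if w = x then 0 else ∑ u, ∑ v, |A u w| * |A v x| * Hk v u) / (1 - lamA) with hCm
  have hJ : ∀ x w : κ, 0 ≤ (if w = x then (0 : ℝ) else ∑ u, ∑ v, |A u w| * |A v x| * Hk v u) := fun x w => by
    split_ifs
    · exact le_rfl
    · exact whitened_cross_nonneg hHk0 A x w
  have hCmnn : ∀ x w, 0 ≤ Cm x w := fun x w => by rw [hCm, Matrix.of_apply]; exact div_nonneg (hJ x w) hl1.le
  have hCmrow : ∀ x, ∑ w, Cm x w ≤ γ := fun x => by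
    simp only [hCm, Matrix.of_apply]
    rw [← Finset.sum_div]
    refine le_trans (div_le_div_of_nonneg_right ?_ hl1.le) hγ
    refine le_trans (Finset.sum_le_sum fun w _ => ?_) (whitened_J_rowsum_le hHk0 hαr hαc hhr x)
    split_ifs
    · exact le_rfl
    · linarith [abs_nonneg ((1 : Matrix κ κ ℝ) x w)]
  have hCmcol : ∀ w, ∑ x, Cm x w ≤ γ' := fun w => by
    simp only [hCm, Matrix.of_apply]
    rw [← Finset.sum_div]
    refine le_trans (div_le_div_of_nonneg_right ?_ hl1.le) hγ'
    refine le_trans (Finset.sum_le_sum fun x _ => ?_) (whitened_J_colsum_le hHk0 hαr hαc hhc w)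
    split_ifs
    · exact le_rfl
    · linarith [abs_nonneg ((1 : Matrix κ κ ℝ) x w)]
  obtain ⟨w₀⟩ := ‹Nonempty κ›
  have hγ0 : 0 ≤ γ := (Finset.sum_nonneg fun z _ => hCmnn w₀ z).trans (hCmrow w₀)
  have hD : ∀ x y, 0 ≤ ∑' n : ℕ, (Cm ^ n) x y := neumann_nonneg hCmnn
  have hDC : ∀ x y, (if x = y then (1 : ℝ) else 0) + ∑ w, (∑' n : ℕ, (Cm ^ n) x w) *
      ((if y = w then 0 else ∑ u, ∑ v, |A u y| * |A v w| * Hk v u) / (1 - lamA)) ≤ ∑' n : ℕ, (Cm ^ n) x y := by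
    intro x y
    have h := neumann_dominates hCmnn hCmrow hγ0 hγ1 x y
    simp only [hCm, Matrix.of_apply] at h ⊢
    exact h
  have hDr : ∀ z, ∑ w, ∑' n : ℕ, (Cm ^ n) z w ≤ (1 - γ)⁻¹ := neumann_rowsum_le hCmnn hCmrow hγ0 hγ1
  have hDc : ∀ w, ∑ z, ∑' n : ℕ, (Cm ^ n) z w ≤ (1 - γ')⁻¹ := neumann_colsum_le hCmnn hCmrow hγ0 hγ1 hCmcol hγ'1
  -- the moment letters in Lebesgue form
  have hV0 : Integrable (fun z : κ → ℝ => exp (-(1 / 2 * (z ⬝ᵥ z) + U (matrixCLM A (WithLp.toLp 2 z) + ψ)))) := by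
    have h := whitened_integrable_lebesgue A ψ (k := fun _ => (1 : ℝ)) (by simpa only [mul_one] using hI0)
    simpa only [one_mul] using h
  have hV2 : ∀ w, Integrable (fun z : κ → ℝ => z w ^ 2 * exp (-(1 / 2 * (z ⬝ᵥ z) + U (matrixCLM A (WithLp.toLp 2 z) + ψ)))) := fun w => by
    have h := whitened_integrable_lebesgue A ψ (k := fun ξ : EuclideanSpace ℝ κ => ξ w ^ 2) (hI2 w)
    simpa only [PiLp.toLp_apply] using h
  have hrow' : ∀ x : κ, ∑ w, (if w = x then (0 : ℝ) else ∑ u, ∑ v, |A u w| * |A v x| * Hk v u) / (1 - lamA) ≤ γ := fun x => by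
    have h := hCmrow x
    simp only [hCm, Matrix.of_apply] at h
    exact h
  -- (447) with the written-out data
  have h := cov_rowsum_le_gibbs (P := P) (D := fun x y => ∑' n : ℕ, (Cm ^ n) x y)
    (V := fun z => 1 / 2 * (z ⬝ᵥ z) + U (matrixCLM A (WithLp.toLp 2 z) + ψ))
    (V₁ := fun x z => z x + U' (matrixCLM A (WithLp.toLp 2 z) + ψ) (matrixCLM A (EuclideanSpace.single x (1 : ℝ))))
    (c := fun _ => 1 - lamA) (Cw := 1 + lamA) (J := fun x w => if w = x then 0 else ∑ u, ∑ v, |A u w| * |A v x| * Hk v u) (γ := γ)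
    (F := fun z => U' (matrixCLM A (WithLp.toLp 2 z) + ψ) (EuclideanSpace.single x (1 : ℝ)))
    (Gf := fun y z => U' (matrixCLM A (WithLp.toLp 2 z) + ψ) (EuclideanSpace.single y (1 : ℝ)))
    (a := fun w => ∑ u, |A u w| * Hk x u) (bf := fun y w => ∑ u, |A u w| * Hk y u)
    (dr := (1 - γ)⁻¹) (dc := (1 - γ')⁻¹) (cmin := 1 - lamA) (κc := αc * hc) Finset.univ
    hP (fun x z => whitenedV_hasDerivAt hUd A ψ x z) (fun x z s t => whitenedV_floor hU'd hHk A hlam ψ x z s t) hcpos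
    (fun x z s t => whitenedV_ceiling hU'd hHk A hlam ψ x z s t)
    (fun x w hw z s t => by rw [if_neg hw]; exact whitenedV_cross hU'd hHk A ψ x w hw z s t)
    (whitenedV_continuous hUd A ψ) hV0 hV2 hJ (fun x => by simp) hrow' hγ0 hγ1 hD hDC hDr hDc hl1 (fun _ => le_rfl)
    (fun w z s t => whitened_obs_lipVec hU'd hHk A ψ x w z s t) (fun y w z s t => whitened_obs_lipVec hU'd hHk A ψ y w z s t)
    (fun w => whitened_obs_colsum_le hHk0 hαc hhc w)
  refine h.trans ?_
  -- `(Σ_w a_w)·κc·dr·dc/cmin ≤ (hr αr)(αc hc)(1−γ)⁻¹(1−γ')⁻¹/(1−lamA)`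
  have ha : ∑ w, ∑ u, |A u w| * Hk x u ≤ hr * αr := whitened_obs_rowsum_le hHk0 hαr hhr x
  have hκc0 : 0 ≤ αc * hc :=
    le_trans (Finset.sum_nonneg fun v _ => whitened_obs_nonneg hHk0 A v w₀) (whitened_obs_colsum_le hHk0 hαc hhc w₀)
  have hγ'0 : 0 ≤ γ' := (Finset.sum_nonneg fun z _ => hCmnn z w₀).trans (hCmcol w₀)
  have hpos : 0 ≤ αc * hc * (1 - γ)⁻¹ * (1 - γ')⁻¹ / (1 - lamA) := by
    have h1 : 0 < 1 - γ := by linarith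
    have h2 : 0 < 1 - γ' := by linarith
    positivity
  calc (∑ w, ∑ u, |A u w| * Hk x u) * (αc * hc) * (1 - γ)⁻¹ * (1 - γ')⁻¹ / (1 - lamA)
      = (∑ w, ∑ u, |A u w| * Hk x u) * (αc * hc * (1 - γ)⁻¹ * (1 - γ')⁻¹ / (1 - lamA)) := by ring
    _ ≤ hr * αr * (αc * hc * (1 - γ)⁻¹ * (1 - γ')⁻¹ / (1 - lamA)) := mul_le_mul_of_nonneg_right ha hpos
    _ = hr * αr * (αc * hc) * (1 - γ)⁻¹ * (1 - γ')⁻¹ / (1 - lamA) := by ring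

/-! ## §4. THE END: the covariance kernel letter under `N(0, AAᵀ)`, no precision condition -/

/-- **THE COVARIANCE KERNEL LETTER WITHOUT A PRECISION CONDITION**: for every factor `A` (`Γ = AAᵀ`, possibly singular), every `U ∈ C²`
with an entrywise Hessian majorant `Hk ≥ 0` (rows `≤ hr`, columns `≤ hc`), the factor's `ℓ¹` letters `αr, αc`, the diagonal letter
`lamA < 1`, the SMALLNESS `αc·hr·αr ≤ γ(1−lamA)`, `αc·hc·αr ≤ γ′(1−lamA)` (`γ, γ′ < 1`) and the whitened moment letters, the tilted covariance
kernel of the gradient components satisfies, for every background `ψ` and site `x`,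
`Σ_y |C_{xy}(ψ)| ≤ (hr·αr)·(αc·hc)·(1−γ)⁻¹(1−γ′)⁻¹∕(1−lamA)` — (439)'s format with `Γ = AAᵀ`. [folklore: Dobrushin 1970, Föllmer 1982] -/
theorem whitened_cov_kernel_rowsum_le [Nonempty κ] (hUd : ∀ φ : EuclideanSpace ℝ ι, HasFDerivAt U (U' φ) φ)
    (hU'd : ∀ φ : EuclideanSpace ℝ ι, HasFDerivAt U' (U'' φ) φ)
    (hHk : ∀ (φ : EuclideanSpace ℝ ι) (x z : ι), |U'' φ (EuclideanSpace.single z (1 : ℝ)) (EuclideanSpace.single x (1 : ℝ))| ≤ Hk x z)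
    (hHk0 : ∀ v u, 0 ≤ Hk v u) (A : Matrix ι κ ℝ) (ψ : EuclideanSpace ℝ ι)
    (hαr : ∀ u, ∑ w, |A u w| ≤ αr) (hαc : ∀ w, ∑ u, |A u w| ≤ αc) (hhr : ∀ v, ∑ u, Hk v u ≤ hr) (hhc : ∀ u, ∑ v, Hk v u ≤ hc)
    (hlam : ∀ x : κ, ∑ u, ∑ v, |A u x| * |A v x| * Hk v u ≤ lamA) (hlam1 : lamA < 1)
    (hγ : αc * hr * αr / (1 - lamA) ≤ γ) (hγ1 : γ < 1) (hγ' : αc * hc * αr / (1 - lamA) ≤ γ') (hγ'1 : γ' < 1)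
    (hI0 : Integrable (fun ξ : EuclideanSpace ℝ κ => exp (-U (matrixCLM A ξ + ψ))) (multivariateGaussian 0 (1 : Matrix κ κ ℝ)))
    (hI2 : ∀ w, Integrable (fun ξ : EuclideanSpace ℝ κ => exp (-U (matrixCLM A ξ + ψ)) * ξ w ^ 2) (multivariateGaussian 0 (1 : Matrix κ κ ℝ)))
    (x : ι) :
    ∑ y, |((∫ ω : EuclideanSpace ℝ ι, exp (-U (ω + ψ)) ∂(multivariateGaussian 0 (A * Aᵀ)))⁻¹ * (∫ ω : EuclideanSpace ℝ ι, exp (-U (ω + ψ)) * (U' (ω + ψ)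
          (EuclideanSpace.single x (1 : ℝ)) * U' (ω + ψ) (EuclideanSpace.single y (1 : ℝ))) ∂(multivariateGaussian 0 (A * Aᵀ))) - ((∫ ω : EuclideanSpace ℝ ι, exp (-U (ω + ψ))
          ∂(multivariateGaussian 0 (A * Aᵀ))) ^ 2)⁻¹ * ((∫ ω : EuclideanSpace ℝ ι, exp (-U (ω + ψ)) * U' (ω + ψ) (EuclideanSpace.single x (1 : ℝ)) ∂(multivariateGaussian 0 (A * Aᵀ))) *
          (∫ ω : EuclideanSpace ℝ ι, exp (-U (ω + ψ)) * U' (ω + ψ) (EuclideanSpace.single y (1 : ℝ)) ∂(multivariateGaussian 0 (A * Aᵀ)))))| ≤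
      hr * αr * (αc * hc) * (1 - γ)⁻¹ * (1 - γ')⁻¹ / (1 - lamA) := by
  have hUc : Continuous U := continuous_iff_continuousAt.2 fun φ => (hUd φ).continuousAt
  have hU'c : Continuous U' := continuous_iff_continuousAt.2 fun φ => (hU'd φ).continuousAt
  -- measurability of the integrands (all continuous)
  have hsh : Continuous fun ω : EuclideanSpace ℝ ι => ω + ψ := continuous_id.add continuous_const
  have he : Continuous fun ω : EuclideanSpace ℝ ι => exp (-U (ω + ψ)) := continuous_exp.comp (hUc.comp hsh).neg
  have hg : ∀ v : ι, Continuous fun ω : EuclideanSpace ℝ ι => U' (ω + ψ) (EuclideanSpace.single v (1 : ℝ)) := fun v =>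
    (hU'c.comp hsh).clm_apply continuous_const
  have hm0 : AEStronglyMeasurable (fun ω : EuclideanSpace ℝ ι => exp (-U (ω + ψ))) (multivariateGaussian 0 (A * Aᵀ)) := he.aestronglyMeasurable
  have hm1 : ∀ v : ι, AEStronglyMeasurable (fun ω : EuclideanSpace ℝ ι => exp (-U (ω + ψ)) * U' (ω + ψ) (EuclideanSpace.single v (1 : ℝ)))
      (multivariateGaussian 0 (A * Aᵀ)) := fun v => (he.mul (hg v)).aestronglyMeasurable
  have hm2 : ∀ v y : ι, AEStronglyMeasurable (fun ω : EuclideanSpace ℝ ι => exp (-U (ω + ψ)) * (U' (ω + ψ) (EuclideanSpace.single v (1 : ℝ)) *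
      U' (ω + ψ) (EuclideanSpace.single y (1 : ℝ)))) (multivariateGaussian 0 (A * Aᵀ)) := fun v y => (he.mul ((hg v).mul (hg y))).aestronglyMeasurable
  -- §3 for the written-out sampler
  have h := whitened_cov_rowsum_le_raw hUd hU'd hHk hHk0 A ψ
    (P := fun x F ω => (∫ s, F (update ω x s) * exp (-(1 / 2 * (update ω x s ⬝ᵥ update ω x s) + U (matrixCLM A (WithLp.toLp 2 (update ω x s)) + ψ)))) /
      ∫ s, exp (-(1 / 2 * (update ω x s ⬝ᵥ update ω x s) + U (matrixCLM A (WithLp.toLp 2 (update ω x s)) + ψ))))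
    (fun _ _ _ => rfl) hαr hαc hhr hhc hlam hlam1 hγ hγ1 hγ' hγ'1 hI0 hI2 x
  refine le_trans (le_of_eq (Finset.sum_congr rfl fun y _ => ?_)) h
  rw [whitened_tilted_eq_gauss A ψ, whitened_tilted_eq_gauss A ψ, whitened_tilted_eq_gauss A ψ]
  simp only [WithLp.toLp_ofLp]
  rw [whitened_integral_eq A hm0, whitened_integral_eq A (hm2 x y), whitened_integral_eq A (hm1 x), whitened_integral_eq A (hm1 y)]
  congr 1
  ring

end Summit.QuantumFields.BalabanUV.T4Continuum.NE7b.SupWhitenedCovarianceKernelLetter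

end
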